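import Literature.AnabelianGeometry.SemiGraphs.TemperedOpenMapping
import Literature.AnabelianGeometry.SemiGraphs.TemperedCurveGaloisInfinite
import Literature.AnabelianGeometry.EtaleTheta.Discharge.Sec2DiscreteNormalizersTemperedFI
import Literature.GroupTheory.CombinatorialGroupTheory.SchreierIndexFormula
import HarnessLib

/-!
# [SemiAnbd] §6: the André tower structure of `Δ^temp_X` from that of `Π^temp_{X_K}`

Mochizuki, *Semi-graphs of anabelioids*, Publ. RIMS **42** (2006) [SemiAnbd], §6 p. 69 (the exact
sequence `1 → Δ^temp_X → Π^temp_{X_K} → G_K → 1`; Lemma 6.1 (ii)(iii), print: [André], Lem. 3.2.1 /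
Cor. 6.2.2) and Example 3.10 p. 43; [EtTh] Lemma 2.17 (ii) p. 59 "quotients of `Π` by characteristic
open subgroups of `Π`, which contain finite rank free normal subgroups of finite index".
[cite: MochizukiSemiAnbd2006, §6 p.69]

PROOF-ONLY file (abc-iut cell, prover abc-iut-w5-d139; no definitions, no named facts).  The kernel
discharges of [SemiAnbd] Lem. 6.1 (iii) / 6.3 (iii) for `Π^temp_{X_K}` (abc-iut-w5-d240) and of [EtTh]
Lem. 2.17 (ii) (L2 lane) all consume ONE structural input `htower₀` for `Π^temp_{X_K}` — cofinal open
normal `N ⊴ Π^temp` such that `Π^temp/N` contains a NON-ABELIAN free normal subgroup of finite index and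
finite rank ([André 2003, §4.5]).  The `Δ^temp_X`-halves (Lem. 6.1 (ii), 6.3 (iii) for `F = Δ^temp_X`;
`TemperedDeltaNormalizers.lean`) consume the same-shaped input for `Δ^temp_X`.  This file DERIVES the
latter from the former for every `X` with `Π^temp_{X_K}` tempered and Galois-countable (first countable
suffices; equivalently the parameter bundle `d : X.GroupLevelData` of ruling η′):

* `TemperedCurve.deltaTemp_tower_of_tower_of_isTempered (hT) [FirstCountableTopology X.PiTemp] (htower₀)`
  and `TemperedCurve.deltaTemp_tower_of_tower (d) (htower₀)` : the `htower₀`-statement for `X.DeltaTemp`.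

Mechanism (classical): for an open normal `N ⊴ Π^temp`, the inclusion induces an injection
`θ : Δ^temp/(N ∩ Δ^temp) ↪ Π^temp/N` with image `Δ^temp N/N`, which has FINITE INDEX because the
augmentation is an open map onto the compact group `G_K` (open-mapping theorem for tempered groups,
`TemperedCurve.isOpenMap_augGK_of_isTempered`); so if `G ≤ Π^temp/N` is free of finite rank, normal, of
finite index and non-abelian, then `θ⁻¹(G) ≅ G ∩ Δ^temp N/N` is a finite-index subgroup of `G` — free of
finite rank by the Schreier index formula (tree: `SchreierIndex.exists_freeGroupBasis_of_finiteIndex`),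
normal, of finite index in `Δ^temp/(N ∩ Δ^temp)`, and non-abelian (`exists_not_commute_of_finiteIndex`).
Nothing here concerns the disputed parts of inter-universal Teichmüller theory or takes a side on
[IUTchIII] Cor. 3.12.
-/

noncomputable section

namespace Literature.AnabelianGeometry.SemiGraphs

namespace TemperedCurve

open _root_.Topology
open scoped Pointwise
open Literature.AnabelianGeometry.EtaleTheta.DiscreteNormalizers
open Literature.GroupTheory.CombinatorialGroupTheory

variable {p : ℕ} [Fact p.Prime] (X : TemperedCurve p)

/-- `Ker(augGK) = Δ^temp_X`. [cite: MochizukiSemiAnbd2006, §6 p.69] -/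
private theorem ker_augGK' : X.augGK.toMonoidHom.ker = X.DeltaTemp := by
  ext g
  rw [MonoidHom.mem_ker]
  change X.augGK g = 1 ↔ X.aug g = 1
  rw [Subtype.ext_iff, coe_augGK_apply]
  rfl

/-- `Δ^temp_X · N` has finite index in `Π^temp_{X_K}` for every open normal `N` (the augmentation is an
open map onto the compact `G_K`). [cite: MochizukiSemiAnbd2006, §6 p.69] -/
private theorem finiteIndex_deltaTemp_sup' (hT : IsTempered X.PiTemp)
    [FirstCountableTopology X.PiTemp] (N : OpenNormalSubgroup X.PiTemp) :
    (X.DeltaTemp ⊔ N.toSubgroup).FiniteIndex := by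
  haveI := X.compactSpace_GK
  have hopen : IsOpen ((N.toSubgroup.map X.augGK.toMonoidHom : Subgroup X.GK) : Set X.GK) := by
    rw [Subgroup.coe_map]
    exact X.isOpenMap_augGK_of_isTempered hT _ N.toOpenSubgroup.isOpen
  haveI : Finite (X.GK ⧸ (N.toSubgroup.map X.augGK.toMonoidHom)) :=
    Subgroup.quotient_finite_of_isOpen _ hopen
  haveI : (N.toSubgroup.map X.augGK.toMonoidHom).FiniteIndex :=
    Subgroup.finiteIndex_of_finite_quotient
  have h : X.DeltaTemp ⊔ N.toSubgroup =
      (N.toSubgroup.map X.augGK.toMonoidHom).comap X.augGK.toMonoidHom := by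
    rw [Subgroup.comap_map_eq, ker_augGK', sup_comm]
  rw [h]
  refine ⟨?_⟩
  rw [Subgroup.index_comap_of_surjective _ X.augGK_surjective]
  exact Subgroup.FiniteIndex.index_ne_zero

/-- **The tower input for `Δ^temp_X` follows from the tower input for `Π^temp_{X_K}`** (for `X` with
`Π^temp_{X_K}` tempered and first countable): if `Π^temp_{X_K}` has cofinally many open normal `N` with `Π^temp/N` containing a
non-abelian free normal subgroup of finite index and finite rank ([André 2003, §4.5]; [EtTh] Lem. 2.17
(ii) p. 59 "quotients of `Π` … contain finite rank free normal subgroups of finite index"), then so does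
`Δ^temp_X` (with the traces `N ∩ Δ^temp_X`): `Δ^temp/(N ∩ Δ^temp) ↪ Π^temp/N` has finite-index image
(open augmentation onto compact `G_K`), and a finite-index subgroup of a non-abelian free group of
finite rank is again non-abelian free of finite rank (Schreier index formula).
[cite: MochizukiSemiAnbd2006, §6 p.69] -/
theorem deltaTemp_tower_of_tower_of_isTempered (hT : IsTempered X.PiTemp)
    [FirstCountableTopology X.PiTemp]
    (htower₀ : ∀ U ∈ 𝓝 (1 : X.PiTemp), ∃ N : OpenNormalSubgroup X.PiTemp, (N : Set X.PiTemp) ⊆ U ∧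
      ∃ (G : Subgroup (X.PiTemp ⧸ N.toSubgroup)) (_ : IsFreeGroup G), G.Normal ∧ G.FiniteIndex ∧
        Finite (IsFreeGroup.Generators G) ∧ ∃ a ∈ G, ∃ b ∈ G, a * b ≠ b * a) :
    ∀ U ∈ 𝓝 (1 : X.DeltaTemp), ∃ N : OpenNormalSubgroup X.DeltaTemp, (N : Set X.DeltaTemp) ⊆ U ∧
      ∃ (G : Subgroup (X.DeltaTemp ⧸ N.toSubgroup)) (_ : IsFreeGroup G), G.Normal ∧ G.FiniteIndex ∧
        Finite (IsFreeGroup.Generators G) ∧ ∃ a ∈ G, ∃ b ∈ G, a * b ≠ b * a := by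
  classical
  intro U hU
  obtain ⟨O, hO, hOU⟩ := (mem_nhds_subtype _ _ _).1 hU
  obtain ⟨N, hNO, G, hG, hGn, hGfi, hGfin, a, ha, b, hb, hab⟩ := htower₀ O (by simpa using hO)
  haveI := hG
  haveI := hGn
  haveI := hGfi
  haveI := hGfin
  -- the trace `NΔ := N ∩ Δ^temp_X`
  obtain ⟨NΔ, mem_NΔ⟩ : ∃ NΔ : OpenNormalSubgroup X.DeltaTemp,
      ∀ {δ : X.DeltaTemp}, δ ∈ NΔ.toSubgroup ↔ (δ : X.PiTemp) ∈ N :=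
    ⟨{ toOpenSubgroup := N.toOpenSubgroup.comap X.DeltaTemp.subtype continuous_subtype_val
       isNormal' := Subgroup.normal_comap _ }, Iff.rfl⟩
  refine ⟨NΔ, fun δ hδ => hOU (hNO (mem_NΔ.1 hδ)), ?_⟩
  -- the quotients and the injection `θ : Δ/(N ∩ Δ) ↪ Π/N`
  let π : X.PiTemp →* X.PiTemp ⧸ N.toSubgroup := QuotientGroup.mk' N.toSubgroup
  let θ : X.DeltaTemp ⧸ NΔ.toSubgroup →* X.PiTemp ⧸ N.toSubgroup :=
    QuotientGroup.map NΔ.toSubgroup N.toSubgroup X.DeltaTemp.subtype fun _ h => mem_NΔ.1 h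
  have hθmk : ∀ δ : X.DeltaTemp, θ (QuotientGroup.mk δ) = π (δ : X.PiTemp) := fun _ => rfl
  have hθinj : Function.Injective θ := by
    rw [injective_iff_map_eq_one]
    intro q hq
    obtain ⟨δ, rfl⟩ := QuotientGroup.mk_surjective q
    rw [hθmk] at hq
    have hδ : (δ : X.PiTemp) ∈ N.toSubgroup := by
      have := (QuotientGroup.eq_one_iff (δ : X.PiTemp)).1 hq
      exact this
    exact (QuotientGroup.eq_one_iff δ).2 (mem_NΔ.2 hδ)
  have hθrange : θ.range = X.DeltaTemp.map π := by
    ext q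
    constructor
    · rintro ⟨r, rfl⟩
      obtain ⟨δ, rfl⟩ := QuotientGroup.mk_surjective r
      exact ⟨δ, δ.2, (hθmk δ).symm⟩
    · rintro ⟨g, hg, rfl⟩
      exact ⟨QuotientGroup.mk ⟨g, hg⟩, hθmk ⟨g, hg⟩⟩
  -- `Δ̄ := Δ^temp N / N` is normal of finite index in `Π/N`
  haveI hΔn : X.DeltaTemp.Normal := by
    change X.aug.toMonoidHom.ker.Normal
    infer_instance
  haveI hΔbar_n : (X.DeltaTemp.map π).Normal :=
    hΔn.map π (QuotientGroup.mk'_surjective _)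
  haveI hΔbar_fi : (X.DeltaTemp.map π).FiniteIndex := by
    refine ⟨?_⟩
    rw [← Subgroup.index_comap_of_surjective _ (QuotientGroup.mk'_surjective N.toSubgroup),
      Subgroup.comap_map_eq, QuotientGroup.ker_mk']
    exact (X.finiteIndex_deltaTemp_sup' hT N).index_ne_zero
  -- `G' := G ∩ Δ̄ ≤ G` has finite index in the free group `G`, hence a finite free basis (Schreier)
  let G' : Subgroup G := (X.DeltaTemp.map π).subgroupOf G
  haveI hG'fi : G'.FiniteIndex := by
    refine ⟨?_⟩
    change (X.DeltaTemp.map π).relIndex G ≠ 0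
    exact ne_zero_of_dvd_ne_zero hΔbar_fi.index_ne_zero
      (Subgroup.relIndex_dvd_index_of_normal _ _)
  obtain ⟨ι, bG', hιfin, -⟩ := SchreierIndex.exists_freeGroupBasis_of_finiteIndex G'
  haveI : Finite ι := hιfin
  -- `GΔ := θ⁻¹(G)`, isomorphic to `G'` via `θ`
  let GΔ : Subgroup (X.DeltaTemp ⧸ NΔ.toSubgroup) := G.comap θ
  let ψ : GΔ →* G := (θ.comp GΔ.subtype).codRestrict G fun q => q.2
  have hψval : ∀ q : GΔ, ((ψ q : G) : X.PiTemp ⧸ N.toSubgroup) = θ q := fun _ => rfl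
  have hψinj : Function.Injective ψ := by
    intro x y h
    apply Subtype.ext
    apply hθinj
    rw [← hψval, ← hψval, h]
  have hψrange : ψ.range = G' := by
    ext y
    rw [Subgroup.mem_subgroupOf]
    constructor
    · rintro ⟨q, rfl⟩
      rw [hψval, ← hθrange]
      exact ⟨q, rfl⟩
    · intro hy
      rw [← hθrange] at hy
      obtain ⟨q, hq⟩ := hy
      have hqG : q ∈ GΔ := by
        change θ q ∈ G
        rw [hq]
        exact y.2
      exact ⟨⟨q, hqG⟩, Subtype.ext (by rw [hψval]; exact hq)⟩
  let e : GΔ ≃* G' := (MonoidHom.ofInjective hψinj).trans (MulEquiv.subgroupCongr hψrange)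
  let bΔ : FreeGroupBasis ι GΔ := bG'.map e.symm
  refine ⟨GΔ, bΔ.isFreeGroup, hGn.comap θ, ?_, ?_, ?_⟩
  · -- finite index: `[Δ/(N∩Δ) : θ⁻¹ G] = [Δ̄ : G ∩ Δ̄] ∣ [Π/N : G]`
    refine ⟨?_⟩
    rw [Subgroup.index_comap, hθrange]
    exact ne_zero_of_dvd_ne_zero hGfi.index_ne_zero (Subgroup.relIndex_dvd_index_of_normal _ _)
  · -- finite rank: the chosen basis of `GΔ` is equipotent with `ι`
    letI := bΔ.isFreeGroup
    exact Finite.of_equiv ι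
      (Equiv.ofFreeGroupEquiv ((IsFreeGroup.toFreeGroup GΔ).symm.trans bΔ.repr)).symm
  · -- non-abelian: a finite-index subgroup of a non-abelian free group is non-abelian
    have hab' : (⟨a, ha⟩ : G) * ⟨b, hb⟩ ≠ ⟨b, hb⟩ * ⟨a, ha⟩ := fun h =>
      hab (by simpa using congrArg Subtype.val h)
    obtain ⟨x, hx, y, hy, hxy⟩ := exists_not_commute_of_finiteIndex hab' G'
    rw [← hψrange] at hx hy
    obtain ⟨qx, rfl⟩ := hx
    obtain ⟨qy, rfl⟩ := hy
    refine ⟨qx, qx.2, qy, qy.2, fun h => hxy ?_⟩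
    have : qx * qy = qy * qx := Subtype.ext h
    rw [← map_mul, ← map_mul, this]

/-- **The tower input for `Δ^temp_X` from the tower input for `Π^temp_{X_K}`** under the parameter
bundle `d : X.GroupLevelData` of ruling η′ ("`Π^temp` tempered", "Galois-countable").
[cite: MochizukiSemiAnbd2006, §6 p.69] -/
theorem deltaTemp_tower_of_tower (d : X.GroupLevelData)
    (htower₀ : ∀ U ∈ 𝓝 (1 : X.PiTemp), ∃ N : OpenNormalSubgroup X.PiTemp, (N : Set X.PiTemp) ⊆ U ∧
      ∃ (G : Subgroup (X.PiTemp ⧸ N.toSubgroup)) (_ : IsFreeGroup G), G.Normal ∧ G.FiniteIndex ∧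
        Finite (IsFreeGroup.Generators G) ∧ ∃ a ∈ G, ∃ b ∈ G, a * b ≠ b * a) :
    ∀ U ∈ 𝓝 (1 : X.DeltaTemp), ∃ N : OpenNormalSubgroup X.DeltaTemp, (N : Set X.DeltaTemp) ⊆ U ∧
      ∃ (G : Subgroup (X.DeltaTemp ⧸ N.toSubgroup)) (_ : IsFreeGroup G), G.Normal ∧ G.FiniteIndex ∧
        Finite (IsFreeGroup.Generators G) ∧ ∃ a ∈ G, ∃ b ∈ G, a * b ≠ b * a := by
  haveI := d.secondCountableTopology
  exact X.deltaTemp_tower_of_tower_of_isTempered d.isTempered htower₀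

end TemperedCurve

end Literature.AnabelianGeometry.SemiGraphs

end
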